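import Mathlib
import Summits.Ventures.PercRepro2.K5Conn
import Summits.Ventures.PercRepro2.TypedUntouched
import Summits.Ventures.PercRepro2.OStarModel

/-!
# The `K₅` model of a two-mark hub (blind cell PercRepro2, mine-2 g40, 2026-08-28;
`proofs/MINE2-HUBK5.md` §1, row M2-85)

A HUB is a pair of confined marks — `(o, b)`, `(o, a₃)` or `(b, a₃)` — adjacent only to marks
(`HubType`).  Its gadget is the seven edges of `K₅` touching the pair (`slotE`); the rest of the
graph attaches at the other three marks `a₁, a₂, x` (`bdE`: the boundary pairs `a₁x, a₂x, a₁a₂`)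
and acts on a copy through its connection pattern `P` on them (`Pat3`: three bits).  The glued
state of a copy is the tree's state of the `K₅` CONFIGURATION `cfg h P N` with the boundary pairs
of `P` and the open slots `N` open (`S`; `st5_eq_S` through typer-1's `K5.conn_iff`).  `PSYM` is
the kernel `KB` on the glued states symmetrised over the three patterns and `C h t P₁ P₂ P₃` the
GADGET SUM of the typing `t : Fin 7 → ℕ` of the slots (`plc` placements, `OStarModel.lean`).
Bookkeeping: `C` is symmetric in the patterns (`C_perm`), a pattern joining the roots contributes
nothing (`C_eq_zero_of_J`), and the decidable facts about the slot and boundary edges.  The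
certificate `0 ≤ C` is NOT decided: `HubCertK5.lean` shows every gadget sum is a positive
multiple of a typed count on a subgraph of `K₅`.  Own code; standard axioms.
-/

namespace Summit.Ventures.PercRepro2

namespace CovForm

namespace THub

open OneTyped Untouched OStar K5

/-! ## The three hubs and their edges of `K₅` -/

/-- The three two-mark hubs: the confined pair `(o, b)`, `(o, a₃)` or `(b, a₃)`. -/
inductive HubType
  | ob
  | oa3
  | ba3
  deriving DecidableEq

namespace HubType

/-- The first confined mark (as the `K₅` index `o = 0, a₁ = 1, a₂ = 2, a₃ = 3, b = 4`). -/
def c₁ : HubType → Fin 5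
  | ob => 0
  | oa3 => 0
  | ba3 => 4

/-- The second confined mark. -/
def c₂ : HubType → Fin 5
  | ob => 4
  | oa3 => 3
  | ba3 => 3

/-- The boundary mark besides the roots. -/
def x : HubType → Fin 5
  | ob => 3
  | oa3 => 4
  | ba3 => 0

/-- The seven slot edges of `K₅` (the edges touching the confined pair), in `edge5` order. -/
def slotE : HubType → Fin 7 → Fin 10
  | ob => ![0, 1, 2, 3, 6, 8, 9]
  | oa3 => ![0, 1, 2, 3, 5, 7, 9]
  | ba3 => ![2, 3, 5, 6, 7, 8, 9]

/-- The three boundary edges of `K₅`: `a₁x`, `a₂x`, `a₁a₂`. -/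
def bdE : HubType → Fin 3 → Fin 10
  | ob => ![5, 7, 4]
  | oa3 => ![6, 8, 4]
  | ba3 => ![0, 1, 4]

/-- The boundary pairs `(a₁, x), (a₂, x), (a₁, a₂)`. -/
def bdPair (h : HubType) : Fin 3 → Fin 5 × Fin 5 := ![(1, h.x), (2, h.x), (1, 2)]

/-- The slot edges are distinct. -/
lemma slotE_injective (h : HubType) : Function.Injective h.slotE := by
  intro i j hij
  cases h <;> fin_cases i <;> fin_cases j <;> first | rfl | exact absurd hij (by decide)

/-- Every edge of `K₅` is a slot or a boundary edge. -/
lemma slot_or_bd (h : HubType) (e : Fin 10) : (∃ i, h.slotE i = e) ∨ ∃ m, h.bdE m = e := by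
  cases h <;> fin_cases e <;> decide

/-- A slot edge touches a confined mark. -/
lemma confined_mem_slot (h : HubType) (i : Fin 7) :
    h.c₁ ∈ ends5 (h.slotE i) ∨ h.c₂ ∈ ends5 (h.slotE i) := by
  cases h <;> fin_cases i <;> decide

/-- A boundary edge touches no confined mark. -/
lemma confined_not_mem_bd (h : HubType) (m : Fin 3) :
    h.c₁ ∉ ends5 (h.bdE m) ∧ h.c₂ ∉ ends5 (h.bdE m) := by
  cases h <;> fin_cases m <;> decide

/-- The ends of a boundary edge are its boundary pair. -/
lemma ends5_bdE (h : HubType) (m : Fin 3) :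
    ends5 (h.bdE m) = s((h.bdPair m).1, (h.bdPair m).2) := by
  cases h <;> fin_cases m <;> decide

/-- Two distinct non-confined marks span a boundary edge. -/
lemma exists_bd_of_ne (h : HubType) : ∀ j p : Fin 5, j ≠ p → j ≠ h.c₁ → j ≠ h.c₂ → p ≠ h.c₁ →
    p ≠ h.c₂ → ∃ m, ends5 (h.bdE m) = s(j, p) := by
  cases h <;> decide

/-- The slots of `K₅` are exactly the edges touching the confined pair. -/
lemma exists_slot_of_mem (h : HubType) (e : Fin 10) (he : h.c₁ ∈ ends5 e ∨ h.c₂ ∈ ends5 e) :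
    ∃ i, h.slotE i = e := by
  rcases h.slot_or_bd e with ⟨i, hi⟩ | ⟨m, hm⟩
  · exact ⟨i, hi⟩
  · exfalso
    rw [← hm] at he
    rcases he with he | he
    · exact (h.confined_not_mem_bd m).1 he
    · exact (h.confined_not_mem_bd m).2 he

/-- A boundary edge is not a slot. -/
lemma bdE_ne_slotE (h : HubType) (m : Fin 3) (i : Fin 7) : h.bdE m ≠ h.slotE i := by
  cases h <;> fin_cases m <;> fin_cases i <;> decide

end HubType

/-! ## Patterns, neighbour sets and the `K₅` configuration -/

/-- A connection pattern of the rest on the boundary marks: the bits `(a₁x, a₂x, a₁a₂)`. -/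
abbrev Pat3 := Bool × Bool × Bool

/-- The open slots of a copy: seven bits in `slotE` order. -/
abbrev Nb7 := Bool × Bool × Bool × Bool × Bool × Bool × Bool

/-- The bit of a pattern. -/
def Pat3.get (P : Pat3) : Fin 3 → Bool
  | 0 => P.1
  | 1 => P.2.1
  | 2 => P.2.2

/-- The bit of a neighbour set. -/
def Nb7.get (N : Nb7) : Fin 7 → Bool
  | 0 => N.1
  | 1 => N.2.1
  | 2 => N.2.2.1
  | 3 => N.2.2.2.1
  | 4 => N.2.2.2.2.1
  | 5 => N.2.2.2.2.2.1
  | 6 => N.2.2.2.2.2.2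

/-- **The `K₅` configuration of a pattern and a neighbour set**: the boundary pairs of `P` and the
slots of `N` open, everything else closed (edges in `edge5` order). -/
def cfg : HubType → Pat3 → Nb7 → Config (Fin 10)
  | .ob, P, N => ![N.1, N.2.1, N.2.2.1, N.2.2.2.1, P.2.2, P.1, N.2.2.2.2.1, P.2.1,
      N.2.2.2.2.2.1, N.2.2.2.2.2.2]
  | .oa3, P, N => ![N.1, N.2.1, N.2.2.1, N.2.2.2.1, P.2.2, N.2.2.2.2.1, P.1, N.2.2.2.2.2.1,
      P.2.1, N.2.2.2.2.2.2]
  | .ba3, P, N => ![P.1, P.2.1, N.1, N.2.1, P.2.2, N.2.2.1, N.2.2.2.1, N.2.2.2.2.1,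
      N.2.2.2.2.2.1, N.2.2.2.2.2.2]

/-- A slot edge of the configuration carries its slot bit. -/
lemma cfg_slotE (h : HubType) (P : Pat3) (N : Nb7) (i : Fin 7) :
    cfg h P N (h.slotE i) = N.get i := by
  cases h <;> fin_cases i <;> rfl

/-- A boundary edge of the configuration carries its pattern bit. -/
lemma cfg_bdE (h : HubType) (P : Pat3) (N : Nb7) (m : Fin 3) :
    cfg h P N (h.bdE m) = P.get m := by
  cases h <;> fin_cases m <;> rfl

/-! ## The glued state -/

/-- **The glued state** `(q′, L_o, H_o, L_b, H_b, L₃, H₃)`: the state of the `K₅` configuration,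
through typer-1's bitmask connectivity `K5.conn`. -/
def S (h : HubType) (P : Pat3) (N : Nb7) : St :=
  (conn (cfg h P N) ((2 : Fin 5) : ℕ) ((1 : Fin 5) : ℕ), conn (cfg h P N) ((1 : Fin 5) : ℕ) ((0 : Fin 5) : ℕ),
    conn (cfg h P N) ((2 : Fin 5) : ℕ) ((0 : Fin 5) : ℕ), conn (cfg h P N) ((1 : Fin 5) : ℕ) ((4 : Fin 5) : ℕ),
    conn (cfg h P N) ((2 : Fin 5) : ℕ) ((4 : Fin 5) : ℕ), conn (cfg h P N) ((1 : Fin 5) : ℕ) ((3 : Fin 5) : ℕ),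
    conn (cfg h P N) ((2 : Fin 5) : ℕ) ((3 : Fin 5) : ℕ))

/-- The decided connection on `K₅` is the bitmask connectivity (any decidability instance). -/
lemma decide_conn5 (ω : Config (Fin 10)) (u v : Fin 5) {d : Decidable (Conn ends5 ω u v)} :
    @decide (Conn ends5 ω u v) d = conn ω u v := by
  rw [Bool.eq_iff_iff, decide_eq_true_eq]
  exact (conn_iff ω u v).symm

/-- The tree's state of the `K₅` configuration is the glued state. -/
lemma st5_eq_S (h : HubType) (P : Pat3) (N : Nb7) :
    st ends5 0 1 2 3 4 (cfg h P N) = S h P N := by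
  unfold st S
  simp only [decide_conn5]

/-- A pattern joining the roots gives a state failing `Q`. -/
lemma S_q'_of_J (h : HubType) {P : Pat3} (hP : P.2.2 = true) (N : Nb7) : (S h P N).q' = true := by
  simp only [S, St.q']
  rw [conn_iff]
  refine conn_of_openAdj ⟨h.bdE 2, ?_, ?_⟩
  · rw [cfg_bdE]; exact hP
  · rw [h.ends5_bdE 2, Sym2.eq_swap]; cases h <;> rfl

/-! ## The symmetrised kernel and the gadget sum -/

/-- The kernel on the glued states, symmetrised over the three patterns. -/
def PSYM (h : HubType) (N₁ N₂ N₃ : Nb7) (P₁ P₂ P₃ : Pat3) : ℤ :=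
  KB (S h P₁ N₁) (S h P₂ N₂) (S h P₃ N₃) + KB (S h P₁ N₁) (S h P₃ N₂) (S h P₂ N₃) +
    KB (S h P₂ N₁) (S h P₁ N₂) (S h P₃ N₃) + KB (S h P₂ N₁) (S h P₃ N₂) (S h P₁ N₃) +
    KB (S h P₃ N₁) (S h P₁ N₂) (S h P₂ N₃) + KB (S h P₃ N₁) (S h P₂ N₂) (S h P₁ N₃)

/-- **The gadget sum** of a typing `t` of the seven slots on a pattern triple: `PSYM` summed over
the placements of the slots (`t i` open copies each). -/
def C (h : HubType) (t : Fin 7 → ℕ) (P₁ P₂ P₃ : Pat3) : ℤ :=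
  ((plc (t 0)).map fun c₀ => ((plc (t 1)).map fun c₁ => ((plc (t 2)).map fun c₂ =>
    ((plc (t 3)).map fun c₃ => ((plc (t 4)).map fun c₄ => ((plc (t 5)).map fun c₅ =>
      ((plc (t 6)).map fun c₆ =>
        PSYM h (c₀.1, c₁.1, c₂.1, c₃.1, c₄.1, c₅.1, c₆.1)
          (c₀.2.1, c₁.2.1, c₂.2.1, c₃.2.1, c₄.2.1, c₅.2.1, c₆.2.1)
          (c₀.2.2, c₁.2.2, c₂.2.2, c₃.2.2, c₄.2.2, c₅.2.2, c₆.2.2) P₁ P₂ P₃).sum).sum).sum).sum).sum).sum).sum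

/-- A pattern is transitive: both roots joined to `x` join each other. -/
def valid (P : Pat3) : Bool := !(P.1 && P.2.1) || P.2.2

/-- `PSYM` is symmetric in its first two patterns. -/
lemma PSYM_swap12 (h : HubType) (N₁ N₂ N₃ : Nb7) (P₁ P₂ P₃ : Pat3) :
    PSYM h N₁ N₂ N₃ P₂ P₁ P₃ = PSYM h N₁ N₂ N₃ P₁ P₂ P₃ := by
  unfold PSYM; ring

/-- `PSYM` is symmetric in its last two patterns. -/
lemma PSYM_swap23 (h : HubType) (N₁ N₂ N₃ : Nb7) (P₁ P₂ P₃ : Pat3) :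
    PSYM h N₁ N₂ N₃ P₁ P₃ P₂ = PSYM h N₁ N₂ N₃ P₁ P₂ P₃ := by
  unfold PSYM; ring

/-- The gadget sum is symmetric in its first two patterns. -/
lemma C_swap12 (h : HubType) (t : Fin 7 → ℕ) (P₁ P₂ P₃ : Pat3) :
    C h t P₂ P₁ P₃ = C h t P₁ P₂ P₃ := by
  unfold C; simp only [PSYM_swap12]

/-- The gadget sum is symmetric in its last two patterns. -/
lemma C_swap23 (h : HubType) (t : Fin 7 → ℕ) (P₁ P₂ P₃ : Pat3) :
    C h t P₁ P₃ P₂ = C h t P₁ P₂ P₃ := by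
  unfold C; simp only [PSYM_swap23]

/-- Any permutation of the patterns, from the two swaps. -/
lemma C_perm (h : HubType) (t : Fin 7 → ℕ) (P₁ P₂ P₃ : Pat3) :
    C h t P₁ P₂ P₃ = C h t P₂ P₁ P₃ ∧ C h t P₁ P₂ P₃ = C h t P₁ P₃ P₂ ∧
      C h t P₁ P₂ P₃ = C h t P₂ P₃ P₁ ∧ C h t P₁ P₂ P₃ = C h t P₃ P₁ P₂ ∧
      C h t P₁ P₂ P₃ = C h t P₃ P₂ P₁ := by
  refine ⟨(C_swap12 ..).symm, (C_swap23 ..).symm, ?_, ?_, ?_⟩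
  · rw [C_swap23 h t P₂ P₁ P₃, C_swap12 h t P₁ P₂ P₃]
  · rw [← C_swap12 h t P₃ P₁ P₂, C_swap23 h t P₁ P₂ P₃]
  · rw [← C_swap12 h t P₃ P₂ P₁, C_swap23 h t P₂ P₁ P₃, C_swap12 h t P₁ P₂ P₃]

/-- `PSYM` vanishes when one of the patterns joins the roots. -/
lemma PSYM_eq_zero_of_J (h : HubType) (N₁ N₂ N₃ : Nb7) {P₁ P₂ P₃ : Pat3}
    (hJ : P₁.2.2 = true ∨ P₂.2.2 = true ∨ P₃.2.2 = true) : PSYM h N₁ N₂ N₃ P₁ P₂ P₃ = 0 := by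
  unfold PSYM
  rcases hJ with hJ | hJ | hJ
  · rw [KB_eq_zero_of_q' _ _ _ (Or.inl (S_q'_of_J h hJ N₁)),
      KB_eq_zero_of_q' _ _ _ (Or.inl (S_q'_of_J h hJ N₁)),
      KB_eq_zero_of_q' _ _ _ (Or.inr (Or.inl (S_q'_of_J h hJ N₂))),
      KB_eq_zero_of_q' _ _ _ (Or.inr (Or.inr (S_q'_of_J h hJ N₃))),
      KB_eq_zero_of_q' _ _ _ (Or.inr (Or.inl (S_q'_of_J h hJ N₂))),
      KB_eq_zero_of_q' _ _ _ (Or.inr (Or.inr (S_q'_of_J h hJ N₃)))]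
    ring
  · rw [KB_eq_zero_of_q' _ _ _ (Or.inr (Or.inl (S_q'_of_J h hJ N₂))),
      KB_eq_zero_of_q' _ _ _ (Or.inr (Or.inr (S_q'_of_J h hJ N₃))),
      KB_eq_zero_of_q' _ _ _ (Or.inl (S_q'_of_J h hJ N₁)),
      KB_eq_zero_of_q' _ _ _ (Or.inl (S_q'_of_J h hJ N₁)),
      KB_eq_zero_of_q' _ _ _ (Or.inr (Or.inr (S_q'_of_J h hJ N₃))),
      KB_eq_zero_of_q' _ _ _ (Or.inr (Or.inl (S_q'_of_J h hJ N₂)))]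
    ring
  · rw [KB_eq_zero_of_q' _ _ _ (Or.inr (Or.inr (S_q'_of_J h hJ N₃))),
      KB_eq_zero_of_q' _ _ _ (Or.inr (Or.inl (S_q'_of_J h hJ N₂))),
      KB_eq_zero_of_q' _ _ _ (Or.inr (Or.inr (S_q'_of_J h hJ N₃))),
      KB_eq_zero_of_q' _ _ _ (Or.inr (Or.inl (S_q'_of_J h hJ N₂))),
      KB_eq_zero_of_q' _ _ _ (Or.inl (S_q'_of_J h hJ N₁)),
      KB_eq_zero_of_q' _ _ _ (Or.inl (S_q'_of_J h hJ N₁))]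
    ring

/-- The gadget sum vanishes when one of the patterns joins the roots. -/
lemma C_eq_zero_of_J (h : HubType) (t : Fin 7 → ℕ) {P₁ P₂ P₃ : Pat3}
    (hJ : P₁.2.2 = true ∨ P₂.2.2 = true ∨ P₃.2.2 = true) : C h t P₁ P₂ P₃ = 0 := by
  unfold C
  simp only [PSYM_eq_zero_of_J h _ _ _ hJ, List.map_const', List.sum_replicate, smul_zero]

end THub

end CovForm

end Summit.Ventures.PercRepro2
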